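import Mathlib
import Summits.ResolutionOfSingularities.ResolutionOfSingularities.Theorems.HomologicalConductorPersistenceArArrivalFloor
import Literature.RingTheory.CohomologyAnnihilator.TowerBasic
import HarnessLib

/-!
# Rung S-2 `PersistenceSurface` (stmt-ResolutionOfSingularities-19970) — the EXACT cohomology
# annihilator of a truncated principal ideal ring, `ca(S/(pᵐ)) = caⁿ⁺¹(S/(pᵐ)) = (p̄^⌊m/2⌋)`, and the
# EXACT `z`-LINE of `ca(A_r)`: `z̄ⁱ ∈ ca(k[x,y,z]/(xy − zᵐ)) ↔ ⌊m/2⌋ ≤ i`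

Route `ResolutionOfSingularities/HomologicalConductor`, chain W4.4b (cell res-hironaka; seat
res-L1-w44b-stub-1 gen 5, completion of the A_r-ARRIVAL FLOOR of `…PersistenceArArrivalFloor`
(p558318) by the matching CEILING). `[OURS · L1 w44b]` replaces the role of no printed item; NOT a
statement of the manuscript under review (Hironaka 2017), nothing here is attributed to its author;
folklore homological algebra, AI-written (weaker than expert review).

`S` a principal ideal domain (for the ceiling alone: a domain), `p ∈ S` irreducible (`p ≠ 0`),
`R = S/(pᵐ)`, `p̄` the class of `p`, `a = ⌊m/2⌋`.

1. **Ceiling from one cyclic module** (`mem_span_pow_min_of_stablyAnnihilates`): if `c ∈ R` stably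
   annihilates `R/(p̄ʲ)` (`j ≤ m`), then `c ∈ (p̄^{min(j, m−j)})`: in a free factorisation
   `R/(p̄ʲ) —ι→ Rˢ —π→ R/(p̄ʲ)`, `π ι = c • id`, the vector `ι(1̄)` is killed by `p̄ʲ`, hence has
   coordinates in `(p̄^{m−j})` (`mem_span_pow_sub_of_pow_mul_eq_zero`), so `c · 1̄ = π ι 1̄ ∈ p̄^{m−j} · R/(p̄ʲ)`,
   i.e. `c ∈ (p̄^{m−j}) + (p̄ʲ) = (p̄^{min(j,m−j)})`.
2. **Every `R/(p̄ʲ)` is an `n`-th syzygy for every `n`** (`exists_isSyzygy_quotient_pow`): the periodic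
   exact sequences `0 → R/(p̄ʲ) —·p̄^{m−j}→ R → R/(p̄^{m−j}) → 0` (`isSyzygy_one_quotient_pow`).
3. **`caⁿ⁺¹(R) = (p̄^⌊m/2⌋)` for every `n`, and `ca(R) = (p̄^⌊m/2⌋)`**
   (`cohomologyAnnihilatorOfDegree_succ_eq_span_pow_half`, `cohomologyAnnihilator_eq_span_pow_half`):
   `⊇` is the floor `mk_pow_half_mem_cohomologyAnnihilatorOfDegree_one` (p558318) pushed up by
   monotonicity; `⊆` is CA1 + 2 + 1 with `j = ⌈m/2⌉`; membership test
   `mk_pow_mem_cohomologyAnnihilator_iff : p̄ⁱ ∈ ca(R) ↔ ⌊m/2⌋ ≤ i`.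
4. **The exact `z`-line of `ca(A_{m−1})`** (`X_two_pow_mem_cohomologyAnnihilator_iff`): for `char k ≠ 2`,
   `z̄ⁱ ∈ ca(k[x,y,z]/(xy − zᵐ)) ↔ ⌊m/2⌋ ≤ i` — stub-2's arena sandwich at the `ca` level
   (`ArenaSandwich.mk_inclusion_mem_cohomologyAnnihilator_iff`, p552485: `ι s ∈ ca(T_h) ↔ s̄ ∈ ca(k[z]/(h))`)
   and 3 for `k[z]/(zᵐ)`. With `m = r + 1`: `zⁱ ∈ ca(A_r) ↔ i ≥ ⌈r/2⌉` — a LOST certificate for the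
   census (`i < ⌈r/2⌉`) as much as a KEPT one.

References: S. B. Iyengar, R. Takahashi, *Annihilation of cohomology and strong generation of module
categories*, IMRN 2016, arXiv:1404.1476, §2 [`IyengarTakahashi2014`].
-/

-- single-problem summit: the doubled namespace component `ResolutionOfSingularities` is forced
set_option linter.dupNamespace false

noncomputable section

open CategoryTheory Literature.RingTheory.CohomologyAnnihilator
open Summit.ResolutionOfSingularities.ResolutionOfSingularities.Theorems.NoZeno.SandwichCluster
open Summit.ResolutionOfSingularities.ResolutionOfSingularities.Theorems.HomologicalConductor.PersistenceSurfaceHullCover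
open Summit.ResolutionOfSingularities.ResolutionOfSingularities.Theorems.HomologicalConductor.PersistenceArArrivalFloor
open Summit.ResolutionOfSingularities.ResolutionOfSingularities.Theorems.HomologicalConductor.ArenaDescent
  (mem_cohomologyAnnihilator_iff_of_ringEquiv)

universe u

namespace Summit.ResolutionOfSingularities.ResolutionOfSingularities.Theorems.HomologicalConductor.PersistenceTruncatedPrincipalCeiling

/-! ## §1 Ideal arithmetic in `R = S/(pᵐ)` -/

/-- `(xᵃ) ⊔ (xᵇ) = (x^{min(a,b)})` for an element `x` of a commutative ring. [folklore] -/
theorem span_pow_sup_span_pow_eq {R : Type u} [CommRing R] (x : R) (a b : ℕ) :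
    Ideal.span {x ^ a} ⊔ Ideal.span {x ^ b} = Ideal.span {x ^ min a b} := by
  rcases le_total a b with h | h
  · rw [min_eq_left h, sup_eq_left]
    exact Ideal.span_singleton_le_span_singleton.mpr (pow_dvd_pow x h)
  · rw [min_eq_right h, sup_eq_right]
    exact Ideal.span_singleton_le_span_singleton.mpr (pow_dvd_pow x h)

section Domain

variable {S : Type u} [CommRing S] [IsDomain S]

/-- In `R = S/(pᵐ)` (`S` a domain, `p ≠ 0`, `j ≤ m`): `p̄ʲ · r = 0 ⇒ r ∈ (p̄^{m−j})` — lift `r = s̄`,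
`pᵐ ∣ pʲ s`, cancel `pʲ`. [folklore] -/
theorem mem_span_pow_sub_of_pow_mul_eq_zero {p : S} (hp : p ≠ 0) {m j : ℕ} (hj : j ≤ m)
    {r : S ⧸ Ideal.span {p ^ m}} (hr : (Ideal.Quotient.mk (Ideal.span {p ^ m}) p) ^ j * r = 0) :
    r ∈ Ideal.span {(Ideal.Quotient.mk (Ideal.span {p ^ m}) p) ^ (m - j)} := by
  obtain ⟨s, rfl⟩ := Ideal.Quotient.mk_surjective r
  rw [← map_pow, ← map_mul, Ideal.Quotient.eq_zero_iff_mem, Ideal.mem_span_singleton] at hr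
  have hm : p ^ m = p ^ j * p ^ (m - j) := by rw [← pow_add, Nat.add_sub_cancel' hj]
  rw [hm, mul_dvd_mul_iff_left (pow_ne_zero j hp)] at hr
  rw [← map_pow, Ideal.mem_span_singleton]
  exact map_dvd _ hr

omit [IsDomain S] in
/-- `p̄ⁱ ∈ (p̄ᵃ)` in `S/(pᵐ)` iff `pⁱ ∈ (pᵃ) + (pᵐ) = (p^{min(a,m)})` in `S`. [folklore] -/
theorem mk_pow_mem_span_mk_pow_iff (p : S) (m a i : ℕ) :
    (Ideal.Quotient.mk (Ideal.span {p ^ m}) p) ^ i ∈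
        Ideal.span {(Ideal.Quotient.mk (Ideal.span {p ^ m}) p) ^ a} ↔
      p ^ i ∈ Ideal.span {p ^ min a m} := by
  have hmap : Ideal.span {Ideal.Quotient.mk (Ideal.span {p ^ m}) (p ^ a)} =
      (Ideal.span {p ^ a}).map (Ideal.Quotient.mk (Ideal.span {p ^ m})) := by
    rw [Ideal.map_span, Set.image_singleton]
  rw [← map_pow, ← map_pow, hmap, Ideal.mem_quotient_iff_mem_sup, span_pow_sup_span_pow_eq]

/-! ## §2 Ceiling from one cyclic module -/

/-- **Ceiling from `R/(p̄ʲ)`.** `S` a domain, `p ≠ 0`, `j ≤ m`, `R = S/(pᵐ)`: if `c ∈ R` stably annihilates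
the cyclic module `R/(p̄ʲ)`, then `c ∈ (p̄^{min(j, m−j)})`. In a FREE factorisation
`R/(p̄ʲ) —ι→ Rˢ —π→ R/(p̄ʲ)` (bridge `stablyAnnihilates_iff_exists_linearMap`) the vector `ι 1̄` is killed
by `p̄ʲ`, so its coordinates lie in `(p̄^{m−j})` and `c • 1̄ = π (ι 1̄) ∈ (p̄^{m−j}) • R/(p̄ʲ)`, i.e.
`c ∈ (p̄^{m−j}) ⊔ (p̄ʲ)`. [folklore] -/
theorem mem_span_pow_min_of_stablyAnnihilates {p : S} (hp : p ≠ 0) {m j : ℕ} (hj : j ≤ m)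
    {c : S ⧸ Ideal.span {p ^ m}}
    (hc : StablyAnnihilates (S ⧸ Ideal.span {p ^ m}) c (ModuleCat.of (S ⧸ Ideal.span {p ^ m})
      ((S ⧸ Ideal.span {p ^ m}) ⧸ Ideal.span {(Ideal.Quotient.mk (Ideal.span {p ^ m}) p) ^ j}))) :
    c ∈ Ideal.span {(Ideal.Quotient.mk (Ideal.span {p ^ m}) p) ^ min j (m - j)} := by
  classical
  obtain ⟨s, ι, π, hιπ⟩ := (stablyAnnihilates_iff_exists_linearMap c _).mp hc
  -- `v = ι 1̄` is killed by `p̄ʲ`, so its coordinates lie in `(p̄^(m-j))`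
  have hone : (Ideal.Quotient.mk (Ideal.span {p ^ m}) p) ^ j •
      (Ideal.Quotient.mk (Ideal.span {(Ideal.Quotient.mk (Ideal.span {p ^ m}) p) ^ j}) 1) = 0 := by
    change Ideal.Quotient.mk _ ((Ideal.Quotient.mk (Ideal.span {p ^ m}) p) ^ j • (1 : S ⧸ Ideal.span {p ^ m})) = 0
    rw [smul_eq_mul, mul_one, Ideal.Quotient.eq_zero_iff_mem]
    exact Ideal.mem_span_singleton_self _
  have hv : ∀ t, ι (Ideal.Quotient.mk _ 1) t ∈
      Ideal.span {(Ideal.Quotient.mk (Ideal.span {p ^ m}) p) ^ (m - j)} := fun t => by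
    refine mem_span_pow_sub_of_pow_mul_eq_zero hp hj ?_
    have h := congrArg (fun w : Fin s → S ⧸ Ideal.span {p ^ m} => w t) (ι.map_smul
      ((Ideal.Quotient.mk (Ideal.span {p ^ m}) p) ^ j) (Ideal.Quotient.mk _ 1))
    simp only [hone, map_zero, Pi.zero_apply, Pi.smul_apply, smul_eq_mul] at h
    exact h.symm
  -- `c • 1̄ = π (ι 1̄) ∈ (p̄^(m-j)) • ⊤`
  have hπ : c • (Ideal.Quotient.mk (Ideal.span {(Ideal.Quotient.mk (Ideal.span {p ^ m}) p) ^ j}) 1) ∈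
      Ideal.span {(Ideal.Quotient.mk (Ideal.span {p ^ m}) p) ^ (m - j)} •
        (⊤ : Submodule (S ⧸ Ideal.span {p ^ m})
          ((S ⧸ Ideal.span {p ^ m}) ⧸ Ideal.span {(Ideal.Quotient.mk (Ideal.span {p ^ m}) p) ^ j})) := by
    have h1 : c • (Ideal.Quotient.mk _ 1) = π (ι (Ideal.Quotient.mk _ 1)) := by
      have := LinearMap.congr_fun hιπ (Ideal.Quotient.mk _ 1)
      simpa using this.symm
    rw [h1, pi_eq_sum_univ' (ι (Ideal.Quotient.mk _ 1)), map_sum]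
    refine Submodule.sum_mem _ fun t _ => ?_
    rw [LinearMap.map_smul]
    exact Submodule.smul_mem_smul (hv t) Submodule.mem_top
  have hc1 : c • (Ideal.Quotient.mk (Ideal.span {(Ideal.Quotient.mk (Ideal.span {p ^ m}) p) ^ j}) 1) =
      Ideal.Quotient.mk (Ideal.span {(Ideal.Quotient.mk (Ideal.span {p ^ m}) p) ^ j}) c := by
    change Ideal.Quotient.mk _ (c • (1 : S ⧸ Ideal.span {p ^ m})) = _
    rw [smul_eq_mul, mul_one]
  rw [hc1, Ideal.smul_top_eq_map, Submodule.restrictScalars_mem, Ideal.Quotient.algebraMap_eq,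
    Ideal.mem_quotient_iff_mem_sup, span_pow_sup_span_pow_eq, min_comm] at hπ
  exact hπ

/-! ## §3 Every `R/(p̄ʲ)` is an `n`-th syzygy, for every `n` -/

/-- **`0 → R/(p̄ʲ) —·p̄^{m−j}→ R → R/(p̄^{m−j}) → 0`** (`S` a domain, `p ≠ 0`, `j ≤ m`): `R/(p̄ʲ)` is a first
syzygy of `R/(p̄^{m−j})` over `R = S/(pᵐ)`. Injectivity of `·p̄^{m−j}` on `R/(p̄ʲ)` is
`mem_span_pow_sub_of_pow_mul_eq_zero` with `m − (m−j) = j`. [folklore] -/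
theorem isSyzygy_one_quotient_pow {p : S} (hp : p ≠ 0) {m j : ℕ} (hj : j ≤ m) :
    IsSyzygy 1
      (ModuleCat.of (S ⧸ Ideal.span {p ^ m})
        ((S ⧸ Ideal.span {p ^ m}) ⧸ Ideal.span {(Ideal.Quotient.mk (Ideal.span {p ^ m}) p) ^ (m - j)}))
      (ModuleCat.of (S ⧸ Ideal.span {p ^ m})
        ((S ⧸ Ideal.span {p ^ m}) ⧸ Ideal.span {(Ideal.Quotient.mk (Ideal.span {p ^ m}) p) ^ j})) := by
  set q : S ⧸ Ideal.span {p ^ m} := Ideal.Quotient.mk (Ideal.span {p ^ m}) p with hq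
  -- `f : R/(q^j) → R`, `r̄ ↦ r · q^(m-j)`
  have hker : Ideal.span {q ^ j} ≤
      LinearMap.ker (LinearMap.toSpanSingleton (S ⧸ Ideal.span {p ^ m}) (S ⧸ Ideal.span {p ^ m})
        (q ^ (m - j))) := by
    rw [Ideal.span_le, Set.singleton_subset_iff, SetLike.mem_coe, LinearMap.mem_ker,
      LinearMap.toSpanSingleton_apply, smul_eq_mul, ← pow_add, Nat.add_sub_cancel' hj, hq, ← map_pow,
      Ideal.Quotient.eq_zero_iff_mem]
    exact Ideal.mem_span_singleton_self _
  let f : ((S ⧸ Ideal.span {p ^ m}) ⧸ Ideal.span {q ^ j}) →ₗ[S ⧸ Ideal.span {p ^ m}]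
      (S ⧸ Ideal.span {p ^ m}) :=
    (Ideal.span {q ^ j}).liftQ (LinearMap.toSpanSingleton _ _ (q ^ (m - j))) hker
  let g : (S ⧸ Ideal.span {p ^ m}) →ₗ[S ⧸ Ideal.span {p ^ m}]
      ((S ⧸ Ideal.span {p ^ m}) ⧸ Ideal.span {q ^ (m - j)}) :=
    (Ideal.span {q ^ (m - j)}).mkQ
  have hf : Function.Injective f := by
    rw [← LinearMap.ker_eq_bot]
    refine Submodule.ker_liftQ_eq_bot _ _ _ fun r hr => ?_
    rw [LinearMap.mem_ker, LinearMap.toSpanSingleton_apply, smul_eq_mul, mul_comm] at hr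
    have h := mem_span_pow_sub_of_pow_mul_eq_zero hp (Nat.sub_le m j) hr
    rwa [Nat.sub_sub_self hj] at h
  have hg : Function.Surjective g := Submodule.mkQ_surjective _
  have hfg : Function.Exact f g := by
    rw [LinearMap.exact_iff, Submodule.ker_mkQ, Submodule.range_liftQ,
      ← LinearMap.span_singleton_eq_range]
  obtain ⟨w, hS⟩ := exists_shortExact_of_linearMap
    (Y := ModuleCat.of (S ⧸ Ideal.span {p ^ m}) ((S ⧸ Ideal.span {p ^ m}) ⧸ Ideal.span {q ^ j}))
    (M := ModuleCat.of (S ⧸ Ideal.span {p ^ m}) (S ⧸ Ideal.span {p ^ m}))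
    (X := ModuleCat.of (S ⧸ Ideal.span {p ^ m}) ((S ⧸ Ideal.span {p ^ m}) ⧸ Ideal.span {q ^ (m - j)}))
    f g hf hg hfg
  exact isSyzygy_one_iff.mpr ⟨ModuleCat.of _ (S ⧸ Ideal.span {p ^ m}), inferInstance,
    (IsProjective.iff_projective (R := S ⧸ Ideal.span {p ^ m}) (S ⧸ Ideal.span {p ^ m})).mp inferInstance,
    _, _, w, hS⟩

/-- **Every `R/(p̄ʲ)` (`j ≤ m`) is an `n`-th syzygy of a finitely generated `R`-module, for every `n`**
(alternate `j ↔ m − j` along `isSyzygy_one_quotient_pow`). [folklore] -/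
theorem exists_isSyzygy_quotient_pow {p : S} (hp : p ≠ 0) (m : ℕ) :
    ∀ (n : ℕ) {j : ℕ}, j ≤ m → ∃ M : ModuleCat.{u} (S ⧸ Ideal.span {p ^ m}),
      Module.Finite (S ⧸ Ideal.span {p ^ m}) M ∧
      IsSyzygy n M (ModuleCat.of (S ⧸ Ideal.span {p ^ m})
        ((S ⧸ Ideal.span {p ^ m}) ⧸ Ideal.span {(Ideal.Quotient.mk (Ideal.span {p ^ m}) p) ^ j}))
  | 0, j, _ => ⟨_, inferInstance, ⟨Iso.refl _⟩⟩
  | n + 1, j, hj => by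
    obtain ⟨M, hM, hn⟩ := exists_isSyzygy_quotient_pow hp m n (Nat.sub_le m j)
    refine ⟨M, hM, ?_⟩
    rw [Nat.add_comm]
    exact hn.trans (isSyzygy_one_quotient_pow hp hj)

/-! ## §4 The exact cohomology annihilator of `S/(pᵐ)` -/

/-- **Ceiling** `caⁿ⁺¹(S/(pᵐ)) ⊆ (p̄^⌊m/2⌋)` (`S` a noetherian domain, `p ≠ 0`): CA1 makes `c ∈ caⁿ⁺¹`
stably annihilate the `n`-th syzygy `R/(p̄^⌈m/2⌉)` (§3), and §2 gives `c ∈ (p̄^{min(⌈m/2⌉, ⌊m/2⌋)})`.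
[cite: IyengarTakahashi2014, Remark 2.13] -/
theorem cohomologyAnnihilatorOfDegree_succ_le_span_pow_half [IsNoetherianRing S] {p : S} (hp : p ≠ 0)
    (m n : ℕ) :
    cohomologyAnnihilatorOfDegree (S ⧸ Ideal.span {p ^ m}) (n + 1) ≤
      Ideal.span {(Ideal.Quotient.mk (Ideal.span {p ^ m}) p) ^ (m / 2)} := by
  intro c hc
  haveI : IsNoetherianRing (S ⧸ Ideal.span {p ^ m}) := Ideal.Quotient.isNoetherianRing _
  have hj : m - m / 2 ≤ m := Nat.sub_le m (m / 2)
  obtain ⟨M, hM, hsyz⟩ := exists_isSyzygy_quotient_pow hp m n hj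
  have hsa := (mem_cohomologyAnnihilatorOfDegree_succ_iff_forall_isSyzygy c).mp hc M _ hM hsyz
  have h := mem_span_pow_min_of_stablyAnnihilates hp hj hsa
  have hmin : min (m - m / 2) (m - (m - m / 2)) = m / 2 := by omega
  rwa [hmin] at h

/-- **Ceiling for the full `ca`**: `ca(S/(pᵐ)) ⊆ (p̄^⌊m/2⌋)` (`S` a noetherian domain, `p ≠ 0`).
[cite: IyengarTakahashi2014, Definition 2.1] -/
theorem cohomologyAnnihilator_le_span_pow_half [IsNoetherianRing S] {p : S} (hp : p ≠ 0) (m : ℕ) :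
    cohomologyAnnihilator (S ⧸ Ideal.span {p ^ m}) ≤
      Ideal.span {(Ideal.Quotient.mk (Ideal.span {p ^ m}) p) ^ (m / 2)} := by
  intro c hc
  obtain ⟨n, hn⟩ := mem_cohomologyAnnihilator_iff.mp hc
  exact cohomologyAnnihilatorOfDegree_succ_le_span_pow_half hp m n
    (cohomologyAnnihilatorOfDegree_mono (Nat.le_succ n) hn)

end Domain

section PID

variable {S : Type u} [CommRing S] [IsDomain S] [IsPrincipalIdealRing S]

/-- **`caⁿ⁺¹(S/(pᵐ)) = (p̄^⌊m/2⌋)` for every `n`** (`S` a PID, `p` irreducible): floor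
`mk_pow_half_mem_cohomologyAnnihilatorOfDegree_one` (p558318) + monotonicity, ceiling
`cohomologyAnnihilatorOfDegree_succ_le_span_pow_half`. [cite: IyengarTakahashi2014, Remark 2.13] -/
theorem cohomologyAnnihilatorOfDegree_succ_eq_span_pow_half {p : S} (hp : Irreducible p) (m n : ℕ) :
    cohomologyAnnihilatorOfDegree (S ⧸ Ideal.span {p ^ m}) (n + 1) =
      Ideal.span {(Ideal.Quotient.mk (Ideal.span {p ^ m}) p) ^ (m / 2)} := by
  refine le_antisymm (cohomologyAnnihilatorOfDegree_succ_le_span_pow_half hp.ne_zero m n) ?_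
  rw [Ideal.span_le, Set.singleton_subset_iff]
  exact cohomologyAnnihilatorOfDegree_mono (by omega : 1 ≤ n + 1)
    (mk_pow_half_mem_cohomologyAnnihilatorOfDegree_one hp m)

/-- **`ca(S/(pᵐ)) = (p̄^⌊m/2⌋)`** (`S` a PID, `p` irreducible). [cite: IyengarTakahashi2014, Definition 2.1] -/
theorem cohomologyAnnihilator_eq_span_pow_half {p : S} (hp : Irreducible p) (m : ℕ) :
    cohomologyAnnihilator (S ⧸ Ideal.span {p ^ m}) =
      Ideal.span {(Ideal.Quotient.mk (Ideal.span {p ^ m}) p) ^ (m / 2)} := by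
  refine le_antisymm (cohomologyAnnihilator_le_span_pow_half hp.ne_zero m) ?_
  rw [Ideal.span_le, Set.singleton_subset_iff]
  exact cohomologyAnnihilatorOfDegree_le 1 (mk_pow_half_mem_cohomologyAnnihilatorOfDegree_one hp m)

/-- **Membership test**: `p̄ⁱ ∈ ca(S/(pᵐ)) ↔ ⌊m/2⌋ ≤ i` (`S` a PID, `p` irreducible).
[cite: IyengarTakahashi2014, Definition 2.1] -/
theorem mk_pow_mem_cohomologyAnnihilator_iff {p : S} (hp : Irreducible p) (m i : ℕ) :
    (Ideal.Quotient.mk (Ideal.span {p ^ m}) p) ^ i ∈ cohomologyAnnihilator (S ⧸ Ideal.span {p ^ m}) ↔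
      m / 2 ≤ i := by
  rw [cohomologyAnnihilator_eq_span_pow_half hp, mk_pow_mem_span_mk_pow_iff,
    min_eq_left (Nat.div_le_self m 2), Ideal.mem_span_singleton, pow_dvd_pow_iff hp.ne_zero hp.not_isUnit]

end PID

/-! ## §5 The truncated polynomial ring and the exact `z`-line of `ca(A_{m−1})` -/

section Polynomial

open Polynomial

variable (k : Type u) [Field k] (m : ℕ)

/-- `ca(k[z]/(zᵐ)) = (z̄^⌊m/2⌋)`. [cite: IyengarTakahashi2014, Definition 2.1] -/
theorem cohomologyAnnihilator_truncatedPolynomial_eq :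
    cohomologyAnnihilator (k[X] ⧸ Ideal.span {(X : k[X]) ^ m}) =
      Ideal.span {(Ideal.Quotient.mk (Ideal.span {(X : k[X]) ^ m}) X) ^ (m / 2)} :=
  cohomologyAnnihilator_eq_span_pow_half Polynomial.irreducible_X m

/-- `z̄ⁱ ∈ ca(k[z]/(zᵐ)) ↔ ⌊m/2⌋ ≤ i` (`Polynomial` presentation). [cite: IyengarTakahashi2014, Definition 2.1] -/
theorem X_pow_mem_cohomologyAnnihilator_iff (i : ℕ) :
    (Ideal.Quotient.mk (Ideal.span {(X : k[X]) ^ m}) X) ^ i ∈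
        cohomologyAnnihilator (k[X] ⧸ Ideal.span {(X : k[X]) ^ m}) ↔ m / 2 ≤ i :=
  mk_pow_mem_cohomologyAnnihilator_iff Polynomial.irreducible_X m i

/-- `z̄ⁱ ∈ ca(k[z]/(zᵐ)) ↔ ⌊m/2⌋ ≤ i` in the one-variable `MvPolynomial (Fin 1) k` presentation (transport
along `Ideal.quotientEquiv`, stub-2's `ArenaDescent.mem_cohomologyAnnihilator_iff_of_ringEquiv`). [cite: IyengarTakahashi2014, Definition 2.1] -/
theorem mvPolynomial_X_pow_mem_cohomologyAnnihilator_iff (i : ℕ) :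
    (Ideal.Quotient.mk (Ideal.span {(MvPolynomial.X 0 : MvPolynomial (Fin 1) k) ^ m}) (MvPolynomial.X 0)) ^ i ∈
        cohomologyAnnihilator
          (MvPolynomial (Fin 1) k ⧸ Ideal.span {(MvPolynomial.X 0 : MvPolynomial (Fin 1) k) ^ m}) ↔
      m / 2 ≤ i := by
  rw [← X_pow_mem_cohomologyAnnihilator_iff k m i,
    mem_cohomologyAnnihilator_iff_of_ringEquiv (Ideal.quotientEquiv (Ideal.span {(X : k[X]) ^ m})
      (Ideal.span {(MvPolynomial.X 0 : MvPolynomial (Fin 1) k) ^ m})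
      (MvPolynomial.uniqueAlgEquiv k (Fin 1)).symm.toRingEquiv (span_X_pow_eq_map k m)),
    map_pow, Ideal.quotientEquiv_mk, AlgEquiv.coe_ringEquiv, uniqueAlgEquiv_symm_X]

/-- **THE EXACT `z`-LINE OF `ca(A_{m−1})`** (`char k ≠ 2`): `z̄ⁱ ∈ ca(k[x,y,z]/(xy − zᵐ)) ↔ ⌊m/2⌋ ≤ i`;
with `m = r + 1`: `zⁱ ∈ ca(A_r) ↔ i ≥ ⌈r/2⌉`. Stub-2's arena sandwich at the `ca` level
(`ArenaSandwich.mk_inclusion_mem_cohomologyAnnihilator_iff`, p552485) + `ca(k[z]/(zᵐ)) = (z̄^⌊m/2⌋)`; the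
ideal `(X 0 · X 1 − ι(zᵐ))` is rewritten to `(X 0 · X 1 − (X 2)ᵐ)` along `Ideal.quotEquivOfEq`.
[cite: IyengarTakahashi2014, Definition 2.1] -/
theorem X_two_pow_mem_cohomologyAnnihilator_iff (h2 : (2 : k) ≠ 0) (i : ℕ) :
    Ideal.Quotient.mk (Ideal.span {(MvPolynomial.X 0 * MvPolynomial.X 1 - MvPolynomial.X 2 ^ m :
        MvPolynomial (Fin 3) k)}) (MvPolynomial.X 2 ^ i) ∈
      cohomologyAnnihilator (MvPolynomial (Fin 3) k ⧸
        Ideal.span {(MvPolynomial.X 0 * MvPolynomial.X 1 - MvPolynomial.X 2 ^ m : MvPolynomial (Fin 3) k)}) ↔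
      m / 2 ≤ i := by
  have hh : ((MvPolynomial.X 0 : MvPolynomial (Fin 1) k) ^ m) ≠ 0 := pow_ne_zero _ (MvPolynomial.X_ne_zero _)
  have hI : Ideal.span {MvPolynomial.X 0 * MvPolynomial.X 1 -
      (MvPolynomial.aeval fun j : Fin (0 + 1) => (MvPolynomial.X j.succ.succ : MvPolynomial (Fin (0 + 3)) k))
        ((MvPolynomial.X 0 : MvPolynomial (Fin 1) k) ^ m)} =
      Ideal.span {(MvPolynomial.X 0 * MvPolynomial.X 1 - MvPolynomial.X 2 ^ m : MvPolynomial (Fin 3) k)} := by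
    rw [aeval_inclusion_X_pow]
  -- (A) the truncated line
  have hA : Ideal.Quotient.mk (Ideal.span {(MvPolynomial.X 0 : MvPolynomial (Fin 1) k) ^ m})
      ((MvPolynomial.X 0 : MvPolynomial (Fin 1) k) ^ i) ∈
        cohomologyAnnihilator
          (MvPolynomial (Fin 1) k ⧸ Ideal.span {(MvPolynomial.X 0 : MvPolynomial (Fin 1) k) ^ m}) ↔
      m / 2 ≤ i := by
    rw [map_pow]
    exact mvPolynomial_X_pow_mem_cohomologyAnnihilator_iff k m i
  -- (B) the sandwich, (C) the ideal rewrite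
  have hB := ArenaSandwich.mk_inclusion_mem_cohomologyAnnihilator_iff k 0 h2 _ hh
    ((MvPolynomial.X 0 : MvPolynomial (Fin 1) k) ^ i)
  have hC := mem_cohomologyAnnihilator_iff_of_ringEquiv (Ideal.quotEquivOfEq hI)
    (Ideal.Quotient.mk _ ((MvPolynomial.aeval fun j : Fin (0 + 1) =>
      (MvPolynomial.X j.succ.succ : MvPolynomial (Fin (0 + 3)) k))
        ((MvPolynomial.X 0 : MvPolynomial (Fin 1) k) ^ i)))
  rw [Ideal.quotEquivOfEq_mk, aeval_inclusion_X_pow k i] at hC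
  rw [aeval_inclusion_X_pow k i] at hB
  exact hC.symm.trans (hB.trans hA)

end Polynomial

end Summit.ResolutionOfSingularities.ResolutionOfSingularities.Theorems.HomologicalConductor.PersistenceTruncatedPrincipalCeiling

end
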